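import Literature.Probability.LatticeModels.ScaleFrameRatioForgetting
import Literature.Probability.LatticeModels.ScaleFrameKernel
import HarnessLib

/-!
# Kesten's ratio forgetting along a scale frame (proved)

Topic `Literature/Probability/LatticeModels` (trunk `StatMech`, family `crit-ising`). The
registered form of H. Kesten's ratio-limit theorem (PTRF 73 (1986), Thm. 3 and §2,
eqs. (16)–(25)) in the planarity-free form of D. Basu, A. Sapozhnikov (ECP 22 (2017), §2) on an
abstract `ScaleFrame`: `ScaleFrame.insideRatio_osc_le` (registered short name
`insideRatio_osc_le`) — the multi-level scheme `ScaleFrame.insideRatio_osc_le_of_key`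
(`ScaleFrameRatioForgetting.lean`) fed with Kesten's Lemma (23) for the chain kernel,
`ScaleFrame.kernel_crossRatio_le` (`ScaleFrameKernel.lean`). Everything is proved; no definitions.

## References
* [Kesten1986] H. Kesten, Probab. Theory Related Fields 73 (1986) 369–394, §2 and Thm. 3.
* [BasuSapozhnikov2017ECP] D. Basu, A. Sapozhnikov, ECP 22 (2017) no. 26, §2.
-/

open MeasureTheory Finset SimpleGraph
open Literature.Probability.Percolation (BondConfig openConnIn openCrossing explEvent)

namespace Literature.Probability.LatticeModels

/-- **(ABS-A) Kesten's ratio forgetting along a scale frame** — at the top level `L` the ratio of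
the two anchors' conditional inside probabilities oscillates over the data by at most any
supersolution `Q L` of the Hopf–Doeblin recursion with cross-ratio constant `K = q⁸/c²⁰` and junk
`ε = (1-c)^(m/2)` (one separator attempt in every other sub-annulus) (Off family: rim wired inside
`U ∖ inSet aL`): the scheme `insideRatio_osc_le_of_key` with Kesten's Lemma (23)
`kernel_crossRatio_le`. [cite: Kesten1986, §2 eqs. (22)–(25) and Thm. 3] -/
theorem ScaleFrame.insideRatio_osc_le :
    ∀ {V : Type*} [Fintype V] [DecidableEq V] (F : ScaleFrame V) {p q c a M : ℝ} {m g L : ℕ},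
      p ∈ Set.Ico (0 : ℝ) 1 → 1 ≤ q → 0 < c → c ≤ 1 → 0 < a → 4 ≤ M → 2 ≤ m → 1 ≤ g → 1 ≤ L →
      (1 - c) ^ (m / 2) < 1 →
      a * M ^ (L * (m + 17 + g) + m + 1) ≤ F.Rmax → F.η ≤ a →
      F.LadderRSWb p q c a M (L * (m + 17 + g) + m + 1) 13 →
    ∀ (x x' : V),
      (∃ w : (fromEdgeSet (↑F.E : Set (Sym2 V))).Walk x x', ∀ z ∈ w.support, z ∈ F.good ∧ F.rad z < a - F.η) →
    ∀ (Q : ℕ → ℝ),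
      q ^ 8 / c ^ 20 / (1 - (1 - c) ^ (m / 2)) ^ 2 ≤ Q 1 →
      (∀ l : ℕ, 1 ≤ l → l < L →
        (1 / (q ^ 8 / c ^ 20) + (1 - 1 / (q ^ 8 / c ^ 20)) * Q l) / (1 - (1 - c) ^ (m / 2)) ^ 2 ≤ Q (l + 1)) →
      let P := rcMeasure (fromEdgeSet (↑F.E : Set (Sym2 V))) p q ∅
      let aL : ℝ := a * M ^ (L * (m + 17 + g))
      let Fd : Set V → Set V → Set (BondConfig V) := fun U R => {ω | ω ∩ (↑F.E : Set (Sym2 V)) ∈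
        explEvent (F.inSet aL) (F.annSet aL (aL * M ^ m)) U R ∩
          {ω | ∀ r ∈ R, ∀ r₂ ∈ R, ∃ v ∈ U \ F.inSet aL, ∃ v' ∈ U \ F.inSet aL,
            s(v, r) ∈ ω ∧ s(v', r₂) ∈ ω ∧ ω ∈ openConnIn (U \ F.inSet aL) v v'}}
      let InP : V → Set V → Set V → Set (BondConfig V) := fun y U R =>
        {ω | ∃ w ∈ R, ∃ v ∈ U, ω ∩ (↑F.E : Set (Sym2 V)) ∈ openConnIn U y v ∧ s(v, w) ∈ ω ∩ (↑F.E : Set (Sym2 V))}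
      let u : V → Set V → Set V → ℝ := fun y U R => P.real (Fd U R ∩ InP y U R) / P.real (Fd U R)
      ∀ (U R U₂ R₂ : Set V), 0 < u x U R → 0 < u x U₂ R₂ →
        u x U R * u x' U₂ R₂ ≤ Q L * (u x' U R * u x U₂ R₂) :=
  ScaleFrame.insideRatio_osc_le_of_key ScaleFrame.kernel_crossRatio_le

/-- **(ABS-A), registered short name** of `ScaleFrame.insideRatio_osc_le` (statement verbatim as
registered on the crux item). [cite: Kesten1986, §2 eqs. (22)–(25) and Thm. 3] -/
theorem insideRatio_osc_le : ∀ {V : Type*} [Fintype V] [DecidableEq V] (F : ScaleFrame V) {p q c a M : ℝ} {m g L : ℕ}, p ∈ Set.Ico (0 : ℝ) 1 → 1 ≤ q → 0 < c → c ≤ 1 → 0 < a → 4 ≤ M → 2 ≤ m → 1 ≤ g → 1 ≤ L → (1 - c) ^ (m / 2) < 1 → a * M ^ (L * (m + 17 + g) + m + 1) ≤ F.Rmax → F.η ≤ a → F.LadderRSWb p q c a M (L * (m + 17 + g) + m + 1) 13 → ∀ (x x' : V), (∃ w : (fromEdgeSet (↑F.E : Set (Sym2 V))).Walk x x', ∀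 z ∈ w.support, z ∈ F.good ∧ F.rad z < a - F.η) → ∀ (Q : ℕ → ℝ), q ^ 8 / c ^ 20 / (1 - (1 - c) ^ (m / 2)) ^ 2 ≤ Q 1 → (∀ l : ℕ, 1 ≤ l → l < L → (1 / (q ^ 8 / c ^ 20) + (1 - 1 / (q ^ 8 / c ^ 20)) * Q l) / (1 - (1 - c) ^ (m / 2)) ^ 2 ≤ Q (l + 1)) → let P := rcMeasure (fromEdgeSet (↑F.E : Set (Sym2 V))) p q ∅; let aL : ℝ := a * M ^ (L * (m + 17 + g)); let Fd : Set V → Set V → Set (BondConfig V) := fun U R => {ω | ω ∩ (↑F.E : Set (Sym2 V)) ∈ explEvent (F.inSet aL) (F.annSet aL (aL * M ^ m)) U R ∩ {ω | ∀ r ∈ R, ∀ r₂ ∈ R, ∃ v ∈ U \ F.inSet aL, ∃ v' ∈ U \ F.inSet aL, s(v, r) ∈ ω ∧ s(v', r₂) ∈ ω ∧ ω ∈ openConnIn (U \ F.inSet aL) v v'}}; let InP : V → Set V → Set V → Set (BondConfig V) := fun y U R => {ω | ∃ w ∈ R, ∃ v ∈ U, ω ∩ (↑F.E : Set (Sym2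 V)) ∈ openConnIn U y v ∧ s(v, w) ∈ ω ∩ (↑F.E : Set (Sym2 V))}; let u : V → Set V → Set V → ℝ := fun y U R => P.real (Fd U R ∩ InP y U R) / P.real (Fd U R); ∀ (U R U₂ R₂ : Set V), 0 < u x U R → 0 < u x U₂ R₂ → u x U R * u x' U₂ R₂ ≤ Q L * (u x' U R * u x U₂ R₂) :=
  ScaleFrame.insideRatio_osc_le

end Literature.Probability.LatticeModels
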